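import Literature.AnabelianGeometry.SemiGraphs.CoveringPullbackLift

/-!
# `φ^* ≅ (A × −) ⋙ toCovering` for the covering `𝒢_A → 𝒢` ([SemiAnbd] Def. 2.2 (i), global clause — brick G5(b))

Mochizuki, *Semi-graphs of anabelioids*, Publ. RIMS **42** (2006) 221–322, §2 p. 23
[cite: MochizukiSemiAnbd2006, Def. 2.2(i) p.23]: `B' = B(𝒢)_{G'}` "arises naturally as the `B(−)`
of … `𝒢'`", i.e. the pull-back functor of `𝒢' → 𝒢` is "`X ↦ (X × A → A)`" followed by the
identification `B(𝒢)_{/A} ≃ B(𝒢')` — the clause `φ^* ≅ Over.star A ⋙ α` of the cell's global covering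
predicate.  For `𝒢' = 𝒢_A`, `φ = coveringHomCan A`, `α = toCovering A`:

* `isPullback_starV` / `starToCoveringVIso` — on the component anabelioids, `(A × B)_v ×_{S_v} P ≅ P × B_v`
  over `P`, as THE comparison of an explicit pull-back square (so with known projections); same for edges;
* `star_glue_comm` — these identifications match the gluings (the canonical `b^*(P × B_v) ×_{b^*P} Q ≅ Q × B_e`
  of `φ^*` versus the pull-back-square gluing of `toCovering`), checked on the two projections of
  `Q × B_e`, the second being the naturality square `BObj.Hom.comm` of `pr₂ : A × B → B`;
* `pullbackFunctorIsoStarComp : φ^* ≅ Over.star A ⋙ toCovering A`.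
-/

namespace Literature.AnabelianGeometry.SemiGraphs

namespace SemiGraphOfAnabelioids

open CategoryTheory CategoryTheory.Limits CategoryTheory.PreGaloisCategory
open Literature.AnabelianGeometry.Anabelioids

universe w' w v₁ u₁ u

-- Mathlib's `Over.pullback` / `Over.star` simp lemmas (`pullback.lift_fst`, …) only fire under the
-- pre-v4.2x defeq transparency behaviour, exactly as in `Mathlib/CategoryTheory/Comma/Over/Pullback.lean`.
set_option backward.isDefEq.respectTransparency false

/-- `(Q × f) ≫ pr₁ = pr₁` for Mathlib's `Over.star`. [cite: MochizukiSemiAnbd2006, Def. 2.2(i) p.23] -/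
@[reassoc] theorem star_map_left_fst {C : Type u₁} [Category.{v₁} C] [HasBinaryProducts C] (X : C)
    {Y Z : C} (f : Y ⟶ Z) : ((Over.star X).map f).left ≫ Limits.prod.fst = Limits.prod.fst := by
  simp

/-- `(Q × f) ≫ pr₂ = pr₂ ≫ f` for Mathlib's `Over.star`. [cite: MochizukiSemiAnbd2006, Def. 2.2(i) p.23] -/
@[reassoc] theorem star_map_left_snd {C : Type u₁} [Category.{v₁} C] [HasBinaryProducts C] (X : C)
    {Y Z : C} (f : Y ⟶ Z) : ((Over.star X).map f).left ≫ Limits.prod.snd = Limits.prod.snd ≫ f := by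
  simp

namespace BObj

variable {𝒢 : SemiGraphOfAnabelioids.{v₁, u₁, u}} (A : 𝒢.BObj)

section Star

variable [HasBinaryProducts 𝒢.BObj]

/-! ### `(A × B)_v ×_{S_v} P ≅ P × B_v` -/

/-- The comparison map `P × B_v → (A × B)_v`: `(P ↪ S_v) × 1` followed by the inverse of
`(A × B)_v ⥲ A_v × B_v` (`ρ_v` preserves products). [cite: MochizukiSemiAnbd2006, Def. 2.2(i) p.23] -/
noncomputable def starVMap (vc : A.fibreData.total.Vertex) (B : 𝒢.BObj) :
    ((A.pullbackV vc).obj B).left ⟶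
      ((Over.post (𝒢.ρ (A.fibreData.proj.vertexMap vc))).obj ((Over.star A).obj B)).left :=
  haveI := preservesBinaryProducts_ρ 𝒢 (A.fibreData.proj.vertexMap vc)
  prod.map (A.vComp vc).1.arrow (𝟙 _) ≫ inv (prodComparison (𝒢.ρ (A.fibreData.proj.vertexMap vc)) A B)

/-- `starVMap ≫ (pr₁)_v = pr₁ ≫ (P ↪ S_v)`. [cite: MochizukiSemiAnbd2006, Def. 2.2(i) p.23] -/
@[reassoc] theorem starVMap_fst (vc : A.fibreData.total.Vertex) (B : 𝒢.BObj) :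
    A.starVMap vc B ≫ (𝒢.ρ (A.fibreData.proj.vertexMap vc)).map (Limits.prod.fst : A ⨯ B ⟶ A) =
      Limits.prod.fst ≫ (A.vComp vc).1.arrow := by
  haveI := preservesBinaryProducts_ρ 𝒢 (A.fibreData.proj.vertexMap vc)
  rw [starVMap, Category.assoc, ← prodComparison_fst, IsIso.inv_hom_id_assoc, prod.map_fst]

/-- `starVMap ≫ (pr₂)_v = pr₂`. [cite: MochizukiSemiAnbd2006, Def. 2.2(i) p.23] -/
@[reassoc] theorem starVMap_snd (vc : A.fibreData.total.Vertex) (B : 𝒢.BObj) :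
    A.starVMap vc B ≫ (𝒢.ρ (A.fibreData.proj.vertexMap vc)).map (Limits.prod.snd : A ⨯ B ⟶ B) =
      Limits.prod.snd := by
  haveI := preservesBinaryProducts_ρ 𝒢 (A.fibreData.proj.vertexMap vc)
  rw [starVMap, Category.assoc, ← prodComparison_snd, IsIso.inv_hom_id_assoc]
  erw [prod.map_snd, Category.comp_id]

/-- Naturality of `starVMap` in `B`. [cite: MochizukiSemiAnbd2006, Def. 2.2(i) p.23] -/
@[reassoc] theorem starVMap_natural (vc : A.fibreData.total.Vertex) {B B' : 𝒢.BObj} (g : B ⟶ B') :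
    prod.map (𝟙 _) ((𝒢.ρ (A.fibreData.proj.vertexMap vc)).map g) ≫ A.starVMap vc B' =
      A.starVMap vc B ≫ (𝒢.ρ (A.fibreData.proj.vertexMap vc)).map (prod.map (𝟙 A) g) := by
  haveI := preservesBinaryProducts_ρ 𝒢 (A.fibreData.proj.vertexMap vc)
  simp only [starVMap, Category.assoc, prodComparison_inv_natural, prod.map_map_assoc,
    Category.id_comp, Category.comp_id, CategoryTheory.Functor.map_id, ρ_obj]

/-- **`P × B_v` is the pull-back `(A × B)_v ×_{S_v} P`**: the square `(starVMap, pr₁; (pr₁)_v, P ↪ S_v)`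
is cartesian. [cite: MochizukiSemiAnbd2006, Def. 2.2(i) p.23] -/
theorem isPullback_starV (vc : A.fibreData.total.Vertex) (B : 𝒢.BObj) :
    IsPullback (A.starVMap vc B) ((A.pullbackV vc).obj B).hom
      ((Over.post (𝒢.ρ (A.fibreData.proj.vertexMap vc))).obj ((Over.star A).obj B)).hom
      (A.vComp vc).1.arrow := by
  haveI := preservesBinaryProducts_ρ 𝒢 (A.fibreData.proj.vertexMap vc)
  have base := isPullback_prod_map_fst (A.vComp vc).1.arrow
    ((𝒢.ρ (A.fibreData.proj.vertexMap vc)).obj B)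
  refine base.of_iso (Iso.refl _) (asIso (prodComparison (𝒢.ρ (A.fibreData.proj.vertexMap vc)) A B)).symm
    (Iso.refl _) (Iso.refl _) ?_ ?_ ?_ ?_
  · rw [Iso.refl_hom, Category.id_comp]
    rfl
  · rw [Iso.refl_hom, Iso.refl_hom, Category.comp_id, Category.id_comp]
    change Limits.prod.fst = prod.lift Limits.prod.fst (𝟙 _) ≫ Limits.prod.fst
    rw [prod.lift_fst]
  · rw [Iso.refl_hom, Category.comp_id, Iso.symm_hom, asIso_inv]
    change Limits.prod.fst = inv (prodComparison (𝒢.ρ (A.fibreData.proj.vertexMap vc)) A B) ≫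
      (𝒢.ρ (A.fibreData.proj.vertexMap vc)).map (prod.lift Limits.prod.fst (𝟙 _) ≫ Limits.prod.fst)
    rw [prod.lift_fst, IsIso.eq_inv_comp, prodComparison_fst]
  · rw [Iso.refl_hom, Iso.refl_hom, Category.comp_id, Category.id_comp]

/-- On the component anabelioid at `(v, P)`: `(A × B)_v ×_{S_v} P ≅ P × B_v` over `P`, naturally in `B` —
THE comparison isomorphism of `isPullback_starV`. [cite: MochizukiSemiAnbd2006, Def. 2.2(i) p.23] -/
noncomputable def starToCoveringVIso (vc : A.fibreData.total.Vertex) :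
    Over.star A ⋙ A.toCoveringV vc ≅ A.pullbackV vc :=
  (NatIso.ofComponents
    (fun B => Over.isoMk (A.isPullback_starV vc B).isoPullback (A.isPullback_starV vc B).isoPullback_hom_snd)
    (fun {B B'} g => by
      ext
      apply pullback.hom_ext
      · rw [Over.comp_left, Over.comp_left, Category.assoc, Category.assoc]
        erw [(A.isPullback_starV vc B').isoPullback_hom_fst]
        rw [Functor.comp_map, toCoveringV_map_left_fst]
        erw [(A.isPullback_starV vc B).isoPullback_hom_fst_assoc]
        exact A.starVMap_natural vc g
      · rw [Over.comp_left, Over.comp_left, Category.assoc, Category.assoc]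
        erw [(A.isPullback_starV vc B').isoPullback_hom_snd]
        rw [Functor.comp_map, toCoveringV_map_left_snd]
        erw [(A.isPullback_starV vc B).isoPullback_hom_snd]
        exact Over.w _)).symm

/-- `starToCoveringVIso` then `starVMap` is the first projection of the pull-back.
[cite: MochizukiSemiAnbd2006, Def. 2.2(i) p.23] -/
@[reassoc] theorem starToCoveringVIso_hom_app_left_comp_starVMap (vc : A.fibreData.total.Vertex)
    (B : 𝒢.BObj) :
    ((A.starToCoveringVIso vc).hom.app B).left ≫ A.starVMap vc B = pullback.fst _ _ :=
  (A.isPullback_starV vc B).isoPullback_inv_fst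

/-- `starToCoveringVIso` to `P`: the second projection of the pull-back.
[cite: MochizukiSemiAnbd2006, Def. 2.2(i) p.23] -/
@[reassoc] theorem starToCoveringVIso_hom_app_left_fst (vc : A.fibreData.total.Vertex) (B : 𝒢.BObj) :
    ((A.starToCoveringVIso vc).hom.app B).left ≫ Limits.prod.fst = pullback.snd _ _ := by
  have e := (A.isPullback_starV vc B).isoPullback_inv_snd
  change _ ≫ (prod.lift Limits.prod.fst (𝟙 _) ≫ Limits.prod.fst) = _ at e
  rw [prod.lift_fst] at e
  exact e

/-- `starToCoveringVIso` to `B_v`: the first projection then `(pr₂)_v`.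
[cite: MochizukiSemiAnbd2006, Def. 2.2(i) p.23] -/
@[reassoc] theorem starToCoveringVIso_hom_app_left_snd (vc : A.fibreData.total.Vertex) (B : 𝒢.BObj) :
    ((A.starToCoveringVIso vc).hom.app B).left ≫ Limits.prod.snd =
      pullback.fst _ _ ≫ (𝒢.ρ (A.fibreData.proj.vertexMap vc)).map (Limits.prod.snd : A ⨯ B ⟶ B) := by
  rw [← starVMap_snd, ← Category.assoc, starToCoveringVIso_hom_app_left_comp_starVMap]

/-! ### `(A × B)_e ×_{T_e} Q ≅ Q × B_e` -/

/-- The comparison map `Q × B_e → (A × B)_e`. [cite: MochizukiSemiAnbd2006, Def. 2.2(i) p.23] -/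
noncomputable def starEMap (ec : A.fibreData.total.Edge) (B : 𝒢.BObj) :
    ((A.pullbackE ec).obj B).left ⟶
      ((Over.post (𝒢.ρE (A.fibreData.proj.edgeMap ec))).obj ((Over.star A).obj B)).left :=
  haveI := preservesBinaryProducts_ρE 𝒢 (A.fibreData.proj.edgeMap ec)
  prod.map (A.eComp ec).1.arrow (𝟙 _) ≫ inv (prodComparison (𝒢.ρE (A.fibreData.proj.edgeMap ec)) A B)

/-- `starEMap ≫ (pr₁)_e = pr₁ ≫ (Q ↪ T_e)`. [cite: MochizukiSemiAnbd2006, Def. 2.2(i) p.23] -/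
@[reassoc] theorem starEMap_fst (ec : A.fibreData.total.Edge) (B : 𝒢.BObj) :
    A.starEMap ec B ≫ (𝒢.ρE (A.fibreData.proj.edgeMap ec)).map (Limits.prod.fst : A ⨯ B ⟶ A) =
      Limits.prod.fst ≫ (A.eComp ec).1.arrow := by
  haveI := preservesBinaryProducts_ρE 𝒢 (A.fibreData.proj.edgeMap ec)
  rw [starEMap, Category.assoc, ← prodComparison_fst, IsIso.inv_hom_id_assoc, prod.map_fst]

/-- `starEMap ≫ (pr₂)_e = pr₂`. [cite: MochizukiSemiAnbd2006, Def. 2.2(i) p.23] -/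
@[reassoc] theorem starEMap_snd (ec : A.fibreData.total.Edge) (B : 𝒢.BObj) :
    A.starEMap ec B ≫ (𝒢.ρE (A.fibreData.proj.edgeMap ec)).map (Limits.prod.snd : A ⨯ B ⟶ B) =
      Limits.prod.snd := by
  haveI := preservesBinaryProducts_ρE 𝒢 (A.fibreData.proj.edgeMap ec)
  rw [starEMap, Category.assoc, ← prodComparison_snd, IsIso.inv_hom_id_assoc]
  erw [prod.map_snd, Category.comp_id]

/-- Naturality of `starEMap` in `B`. [cite: MochizukiSemiAnbd2006, Def. 2.2(i) p.23] -/
@[reassoc] theorem starEMap_natural (ec : A.fibreData.total.Edge) {B B' : 𝒢.BObj} (g : B ⟶ B') :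
    prod.map (𝟙 _) ((𝒢.ρE (A.fibreData.proj.edgeMap ec)).map g) ≫ A.starEMap ec B' =
      A.starEMap ec B ≫ (𝒢.ρE (A.fibreData.proj.edgeMap ec)).map (prod.map (𝟙 A) g) := by
  haveI := preservesBinaryProducts_ρE 𝒢 (A.fibreData.proj.edgeMap ec)
  simp only [starEMap, Category.assoc, prodComparison_inv_natural, prod.map_map_assoc,
    Category.id_comp, Category.comp_id, CategoryTheory.Functor.map_id, ρE_obj]

/-- `Q × B_e` is the pull-back `(A × B)_e ×_{T_e} Q`. [cite: MochizukiSemiAnbd2006, Def. 2.2(i) p.23] -/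
theorem isPullback_starE (ec : A.fibreData.total.Edge) (B : 𝒢.BObj) :
    IsPullback (A.starEMap ec B) ((A.pullbackE ec).obj B).hom
      ((Over.post (𝒢.ρE (A.fibreData.proj.edgeMap ec))).obj ((Over.star A).obj B)).hom
      (A.eComp ec).1.arrow := by
  haveI := preservesBinaryProducts_ρE 𝒢 (A.fibreData.proj.edgeMap ec)
  have base := isPullback_prod_map_fst (A.eComp ec).1.arrow
    ((𝒢.ρE (A.fibreData.proj.edgeMap ec)).obj B)
  refine base.of_iso (Iso.refl _) (asIso (prodComparison (𝒢.ρE (A.fibreData.proj.edgeMap ec)) A B)).symm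
    (Iso.refl _) (Iso.refl _) ?_ ?_ ?_ ?_
  · rw [Iso.refl_hom, Category.id_comp]
    rfl
  · rw [Iso.refl_hom, Iso.refl_hom, Category.comp_id, Category.id_comp]
    change Limits.prod.fst = prod.lift Limits.prod.fst (𝟙 _) ≫ Limits.prod.fst
    rw [prod.lift_fst]
  · rw [Iso.refl_hom, Category.comp_id, Iso.symm_hom, asIso_inv]
    change Limits.prod.fst = inv (prodComparison (𝒢.ρE (A.fibreData.proj.edgeMap ec)) A B) ≫
      (𝒢.ρE (A.fibreData.proj.edgeMap ec)).map (prod.lift Limits.prod.fst (𝟙 _) ≫ Limits.prod.fst)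
    rw [prod.lift_fst, IsIso.eq_inv_comp, prodComparison_fst]
  · rw [Iso.refl_hom, Iso.refl_hom, Category.comp_id, Category.id_comp]

/-- On the component anabelioid at `(e, Q)`: `(A × B)_e ×_{T_e} Q ≅ Q × B_e` over `Q`, naturally in `B`.
[cite: MochizukiSemiAnbd2006, Def. 2.2(i) p.23] -/
noncomputable def starToCoveringEIso (ec : A.fibreData.total.Edge) :
    Over.star A ⋙ A.toCoveringE ec ≅ A.pullbackE ec :=
  (NatIso.ofComponents
    (fun B => Over.isoMk (A.isPullback_starE ec B).isoPullback (A.isPullback_starE ec B).isoPullback_hom_snd)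
    (fun {B B'} g => by
      ext
      apply pullback.hom_ext
      · rw [Over.comp_left, Over.comp_left, Category.assoc, Category.assoc]
        erw [(A.isPullback_starE ec B').isoPullback_hom_fst]
        rw [Functor.comp_map, toCoveringE_map_left_fst]
        erw [(A.isPullback_starE ec B).isoPullback_hom_fst_assoc]
        exact A.starEMap_natural ec g
      · rw [Over.comp_left, Over.comp_left, Category.assoc, Category.assoc]
        erw [(A.isPullback_starE ec B').isoPullback_hom_snd]
        rw [Functor.comp_map, toCoveringE_map_left_snd]
        erw [(A.isPullback_starE ec B).isoPullback_hom_snd]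
        exact Over.w _)).symm

/-- `starToCoveringEIso` then `starEMap` is the first projection of the pull-back.
[cite: MochizukiSemiAnbd2006, Def. 2.2(i) p.23] -/
@[reassoc] theorem starToCoveringEIso_hom_app_left_comp_starEMap (ec : A.fibreData.total.Edge)
    (B : 𝒢.BObj) :
    ((A.starToCoveringEIso ec).hom.app B).left ≫ A.starEMap ec B = pullback.fst _ _ :=
  (A.isPullback_starE ec B).isoPullback_inv_fst

/-- `starToCoveringEIso` to `Q`: the second projection of the pull-back.
[cite: MochizukiSemiAnbd2006, Def. 2.2(i) p.23] -/
@[reassoc] theorem starToCoveringEIso_hom_app_left_fst (ec : A.fibreData.total.Edge) (B : 𝒢.BObj) :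
    ((A.starToCoveringEIso ec).hom.app B).left ≫ Limits.prod.fst = pullback.snd _ _ := by
  have e := (A.isPullback_starE ec B).isoPullback_inv_snd
  change _ ≫ (prod.lift Limits.prod.fst (𝟙 _) ≫ Limits.prod.fst) = _ at e
  rw [prod.lift_fst] at e
  exact e

/-- `starToCoveringEIso` to `B_e`: the first projection then `(pr₂)_e`.
[cite: MochizukiSemiAnbd2006, Def. 2.2(i) p.23] -/
@[reassoc] theorem starToCoveringEIso_hom_app_left_snd (ec : A.fibreData.total.Edge) (B : 𝒢.BObj) :
    ((A.starToCoveringEIso ec).hom.app B).left ≫ Limits.prod.snd =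
      pullback.fst _ _ ≫ (𝒢.ρE (A.fibreData.proj.edgeMap ec)).map (Limits.prod.snd : A ⨯ B ⟶ B) := by
  rw [← starEMap_snd, ← Category.assoc, starToCoveringEIso_hom_app_left_comp_starEMap]

/-- The same at the component named by a BRANCH `(b, Q)` (definitionally `starToCoveringEIso (edgeOf (b,Q))`,
retyped over the edge of `b`). [cite: MochizukiSemiAnbd2006, Def. 2.2(i) p.23] -/
noncomputable def starToCoveringBrIso (bc : A.fibreData.total.Branch) :
    Over.star A ⋙ A.toCoveringBr bc ≅
      𝒢.ρE (𝒢.graph.edgeOf (A.fibreData.proj.branchMap bc)) ⋙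
        Over.star ((A.brComp bc).1 : 𝒢.E (𝒢.graph.edgeOf (A.fibreData.proj.branchMap bc))) :=
  A.starToCoveringEIso (A.fibreData.total.edgeOf bc)

/-- `starToCoveringBrIso` to `Q`. [cite: MochizukiSemiAnbd2006, Def. 2.2(i) p.23] -/
@[reassoc] theorem starToCoveringBrIso_hom_app_left_fst (bc : A.fibreData.total.Branch) (B : 𝒢.BObj) :
    ((A.starToCoveringBrIso bc).hom.app B).left ≫ Limits.prod.fst = pullback.snd _ _ :=
  A.starToCoveringEIso_hom_app_left_fst (A.fibreData.total.edgeOf bc) B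

/-- `starToCoveringBrIso` to `B_e`: the first projection then `(pr₂)_e`.
[cite: MochizukiSemiAnbd2006, Def. 2.2(i) p.23] -/
@[reassoc] theorem starToCoveringBrIso_hom_app_left_snd (bc : A.fibreData.total.Branch) (B : 𝒢.BObj) :
    ((A.starToCoveringBrIso bc).hom.app B).left ≫ Limits.prod.snd =
      pullback.fst _ _ ≫
        (𝒢.ρE (𝒢.graph.edgeOf (A.fibreData.proj.branchMap bc))).map (Limits.prod.snd : A ⨯ B ⟶ B) :=
  A.starToCoveringEIso_hom_app_left_snd (A.fibreData.total.edgeOf bc) B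

/-! ### Compatibility with the gluings -/

/-- **The identifications `(A × B)_v ×_{S_v} P ≅ P × B_v` match the gluings** of `toCovering A`
(pull-back squares) and of `φ^*` (the canonical `b^*(P × B_v) ×_{b^*P} Q ≅ Q × B_e`): checked on the
two projections of `Q × B_e`, the second by the naturality square `BObj.Hom.comm` of `pr₂ : A × B → B`
along `b`. [cite: MochizukiSemiAnbd2006, Def. 2.2(i) p.23] -/
theorem star_glue_comm (bc : A.fibreData.total.Branch) (vc : A.fibreData.total.Vertex)
    (h : A.fibreData.total.abuts bc = some vc) (B : 𝒢.BObj) :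
    (A.gluingAt bc vc h).map ((A.starToCoveringVIso vc).hom.app B) ≫ (A.pullbackGlue bc vc h).hom.app B =
      (Functor.isoWhiskerLeft (Over.star A) (A.toCoveringGlue bc vc h)).hom.app B ≫
        (A.starToCoveringEIso (A.fibreData.total.edgeOf bc)).hom.app B := by
  change (A.gluingAt bc vc h).map ((A.starToCoveringVIso vc).hom.app B) ≫
      ((A.gluingStarIsoCan (abuts_fst h) (A.vComp vc).1 (A.brComp bc).1 (brComp_le_branchImage h)).hom.app
          (B.S (A.fibreData.proj.vertexMap vc)) ≫
        (Over.star ((A.brComp bc).1 : 𝒢.E (𝒢.graph.edgeOf (A.fibreData.proj.branchMap bc)))).map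
          (B.ψ (A.fibreData.proj.branchMap bc) (A.fibreData.proj.vertexMap vc) (abuts_fst h)).hom) =
    (A.toCoveringGlueApp bc vc h ((Over.star A).obj B)).hom ≫ (A.starToCoveringBrIso bc).hom.app B
  ext
  rw [Over.comp_left, Over.comp_left, Over.comp_left]
  apply Limits.prod.hom_ext
  · -- to `Q`
    simp only [Category.assoc]
    erw [A.starToCoveringBrIso_hom_app_left_fst bc B]
    erw [A.toCoveringGlueApp_hom_left_snd bc vc h ((Over.star A).obj B)]
    erw [star_map_left_fst]
    erw [A.gluingStarIsoCan_hom_app_left_fst]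
    erw [A.gluingAt_map_left_snd]
    rfl
  · -- to `B_e`
    simp only [Category.assoc]
    erw [A.starToCoveringBrIso_hom_app_left_snd bc B]
    erw [A.toCoveringGlueApp_hom_left_fst_assoc bc vc h ((Over.star A).obj B)]
    erw [star_map_left_snd]
    erw [A.gluingStarIsoCan_hom_app_left_snd_assoc]
    erw [A.gluingAt_map_left_fst_assoc]
    rw [← Functor.map_comp_assoc]
    erw [A.starToCoveringVIso_hom_app_left_snd vc B]
    rw [Functor.map_comp_assoc]
    erw [(Limits.prod.snd : A ⨯ B ⟶ B).comm (A.fibreData.proj.branchMap bc) (A.fibreData.proj.vertexMap vc)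
      (abuts_fst h)]
    rfl

/-! ### Assembly -/

/-- `Over.star A ⋙ toCovering A` is the functor lifted from the whiskered data (definitionally).
[cite: MochizukiSemiAnbd2006, Def. 2.2(i) p.23] -/
theorem star_comp_toCovering :
    Over.star A ⋙ A.toCovering =
      A.liftOver (fun vc => Over.star A ⋙ A.toCoveringV vc) (fun ec => Over.star A ⋙ A.toCoveringE ec)
        (fun bc vc h => Functor.isoWhiskerLeft (Over.star A) (A.toCoveringGlue bc vc h)) :=
  rfl

/-- **`φ^* ≅ (A × −) ⋙ toCovering A`**: the pull-back functor of the covering `𝒢_A → 𝒢` (canonical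
2-cells) is "product with `A`" followed by the comparison functor `B(𝒢)_{/A} ⥤ B(𝒢_A)`.
[cite: MochizukiSemiAnbd2006, Def. 2.2(i) p.23] -/
noncomputable def pullbackFunctorIsoStarComp :
    A.coveringHomCan.pullbackFunctor ≅ Over.star A ⋙ A.toCovering :=
  A.pullbackFunctorIsoLiftOver ≪≫
    (A.liftOverIso (fun vc => A.starToCoveringVIso vc) (fun ec => A.starToCoveringEIso ec)
      (fun bc vc h B => A.star_glue_comm bc vc h B)).symm ≪≫
    eqToIso A.star_comp_toCovering.symm

end Star

end BObj

end SemiGraphOfAnabelioids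

end Literature.AnabelianGeometry.SemiGraphs
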